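import Literature.MathematicalPhysics.QuantumManyBody.BoseEinsteinCondensation
import Literature.MathematicalPhysics.QuantumManyBody.LiebYngvasonPoincare
import Mathlib.MeasureTheory.Group.LIntegral
import Mathlib.Analysis.Real.Pi.Bounds

/-!
# Route `BECThomsonPrinciple`, crux `PeriodicToDirichlet` (stmt-AtomisticToContinuum-9483),
# line `Sketch` (torus-in-the-box-doob): registered stub `stub_shellMass`

The one-body Hardy layer bound for Dirichlet trial states: the expected number of particles within
`b` of the boundary of the box is at most `(b²/2) ∫ |∇Ψ|²`. [folklore]

Proof.  For one coordinate direction `e = e_{i,k}` and the line `t ↦ X + t e` through a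
configuration `X`, the section `w(s) = Ψ(X + (s - X_{ik}) e)` is `C¹` and vanishes at `s = 0` and
`s = L` (Dirichlet condition off the open box), so the quarter-period bound of the tree
(`Poincare.quarter_period_sq_mul_integral_le`, constant `(2b/π)² ≤ b²/2`) on `(0, b)` and on
`(L - b, L)` gives `∫_{layer} |w|² ≤ (b²/2) ∫_{(0,L)} |w'|²`.  The line bounds are integrated over
`X` by averaging over translates along `e` (translation invariance of Lebesgue measure on
`(ℝ³)^N` and Tonelli on `(ℝ³)^N × ℝ`; no coordinate splitting is needed), and summed over the
`3N` directions.
-/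

noncomputable section

open MeasureTheory Filter
open scoped ENNReal NNReal

namespace Summit.AtomisticToContinuum.BoseEinsteinCondensation.TorusInTheBox

open Literature.MathematicalPhysics.QuantumManyBody.BoseGas

/-! ### One dimension: the quarter-period bound at a face where the function vanishes -/

/-- **Face bound on an interval** (`ℝ≥0∞` form): for `w ∈ C¹(ℝ; ℂ)` vanishing at one end of
`[a, c]`, `∫_a^c |w|² ≤ ((c-a)²/2) ∫_a^c |w'|²` (from the sharp quarter-period constant
`(2(c-a)/π)² ≤ (c-a)²/2`, as `π² ≥ 8`). [folklore] -/
private theorem lintegral_Ioo_nnnorm_sq_le {a c : ℝ} (hac : a < c) {w : ℝ → ℂ}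
    (hw : ContDiff ℝ 1 w) (h0 : w a = 0 ∨ w c = 0) :
    ∫⁻ t in Set.Ioo a c, (‖w t‖₊ : ℝ≥0∞) ^ 2 ≤
      ENNReal.ofReal ((c - a) ^ 2 / 2) * ∫⁻ t in Set.Ioo a c, (‖deriv w t‖₊ : ℝ≥0∞) ^ 2 := by
  have hq := Poincare.quarter_period_sq_mul_integral_le (E := ℂ) hac hw h0
  have hconv : ∀ g : ℝ → ℝ, ∫ t in Set.Ioo a c, g t = ∫ t in a..c, g t := fun g => by
    rw [intervalIntegral.integral_of_le hac.le, integral_Ioc_eq_integral_Ioo]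
  have hi1 : IntegrableOn (fun t => ‖w t‖ ^ 2) (Set.Ioo a c) :=
    (hw.continuous.norm.pow 2).integrableOn_Icc.mono_set Set.Ioo_subset_Icc_self
  have hi2 : IntegrableOn (fun t => ‖deriv w t‖ ^ 2) (Set.Ioo a c) :=
    (hw.continuous_deriv_one.norm.pow 2).integrableOn_Icc.mono_set Set.Ioo_subset_Icc_self
  have e1 : ∫⁻ t in Set.Ioo a c, (‖w t‖₊ : ℝ≥0∞) ^ 2 =
      ENNReal.ofReal (∫ t in Set.Ioo a c, ‖w t‖ ^ 2) := by
    rw [ofReal_integral_eq_lintegral_ofReal hi1 (ae_of_all _ fun t => by positivity)]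
    exact lintegral_congr fun t => (Poincare.ofReal_norm_sq _).symm
  have e2 : ∫⁻ t in Set.Ioo a c, (‖deriv w t‖₊ : ℝ≥0∞) ^ 2 =
      ENNReal.ofReal (∫ t in Set.Ioo a c, ‖deriv w t‖ ^ 2) := by
    rw [ofReal_integral_eq_lintegral_ofReal hi2 (ae_of_all _ fun t => by positivity)]
    exact lintegral_congr fun t => (Poincare.ofReal_norm_sq _).symm
  rw [e1, e2, ← ENNReal.ofReal_mul (by positivity)]
  refine ENNReal.ofReal_le_ofReal ?_
  rw [hconv, hconv]
  have hca : 0 < c - a := sub_pos.2 hac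
  have hI : 0 ≤ ∫ t in a..c, ‖w t‖ ^ 2 :=
    intervalIntegral.integral_nonneg hac.le fun t _ => by positivity
  have hπ : 3 < Real.pi := Real.pi_gt_three
  have h9 : 9 < Real.pi ^ 2 := by nlinarith [hπ, Real.pi_pos]
  have hcoef : 2 / (c - a) ^ 2 ≤ (Real.pi / (2 * (c - a))) ^ 2 := by
    rw [div_pow, mul_pow, div_le_div_iff₀ (by positivity) (by positivity)]
    nlinarith [sq_nonneg (c - a), h9]
  calc ∫ t in a..c, ‖w t‖ ^ 2
      = (c - a) ^ 2 / 2 * (2 / (c - a) ^ 2 * ∫ t in a..c, ‖w t‖ ^ 2) := by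
        rw [← mul_assoc, div_mul_div_comm, mul_comm ((c - a) ^ 2) 2, div_self (by positivity),
          one_mul]
    _ ≤ (c - a) ^ 2 / 2 * ((Real.pi / (2 * (c - a))) ^ 2 * ∫ t in a..c, ‖w t‖ ^ 2) :=
        mul_le_mul_of_nonneg_left (mul_le_mul_of_nonneg_right hcoef hI) (by positivity)
    _ ≤ (c - a) ^ 2 / 2 * ∫ t in a..c, ‖deriv w t‖ ^ 2 :=
        mul_le_mul_of_nonneg_left hq (by positivity)

/-- The `b`-layer `{0 < s < L, s < b ∨ L - b < s}` of the interval `(0, L)` is measurable.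
[folklore] -/
private theorem measurableSet_layer (L b : ℝ) :
    MeasurableSet {s : ℝ | 0 < s ∧ s < L ∧ (s < b ∨ L - b < s)} :=
  measurableSet_Ioi.inter (measurableSet_Iio.inter (measurableSet_Iio.union measurableSet_Ioi))

/-- **Both faces**: for `w ∈ C¹(ℝ; ℂ)` with `w 0 = w L = 0`, `0 < b`, `2b ≤ L`,
`∫_{0<s<L, s<b ∨ L-b<s} |w|² ≤ (b²/2) ∫_{(0,L)} |w'|²` (the face bound on `(0,b)` and on
`(L-b,L)`, which are disjoint). [folklore] -/
private theorem lintegral_layer_nnnorm_sq_le {L b : ℝ} (hb : 0 < b) (hbL : 2 * b ≤ L)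
    {w : ℝ → ℂ} (hw : ContDiff ℝ 1 w) (h0 : w 0 = 0) (hL : w L = 0) :
    ∫⁻ t in {s : ℝ | 0 < s ∧ s < L ∧ (s < b ∨ L - b < s)}, (‖w t‖₊ : ℝ≥0∞) ^ 2 ≤
      ENNReal.ofReal (b ^ 2 / 2) * ∫⁻ t in Set.Ioo 0 L, (‖deriv w t‖₊ : ℝ≥0∞) ^ 2 := by
  have hset : {s : ℝ | 0 < s ∧ s < L ∧ (s < b ∨ L - b < s)} =
      Set.Ioo 0 b ∪ Set.Ioo (L - b) L := by
    ext s
    simp only [Set.mem_setOf_eq, Set.mem_union, Set.mem_Ioo]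
    constructor
    · rintro ⟨h1, h2, h3 | h3⟩
      · exact Or.inl ⟨h1, h3⟩
      · exact Or.inr ⟨h3, h2⟩
    · rintro (⟨h1, h2⟩ | ⟨h1, h2⟩)
      · exact ⟨h1, by linarith, Or.inl h2⟩
      · exact ⟨by linarith, h2, Or.inr h1⟩
  have h1 := lintegral_Ioo_nnnorm_sq_le hb hw (Or.inl h0)
  have h2 := lintegral_Ioo_nnnorm_sq_le (show L - b < L by linarith) hw (Or.inr hL)
  rw [sub_zero] at h1
  rw [sub_sub_cancel] at h2
  have hdisj : Disjoint (Set.Ioo 0 b) (Set.Ioo (L - b) L) :=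
    Set.disjoint_left.2 fun s hs hs' => by linarith [hs.2, hs'.1]
  have hsub : Set.Ioo 0 b ∪ Set.Ioo (L - b) L ⊆ Set.Ioo 0 L :=
    Set.union_subset (Set.Ioo_subset_Ioo_right (by linarith))
      (Set.Ioo_subset_Ioo_left (by linarith))
  rw [hset]
  calc ∫⁻ t in Set.Ioo 0 b ∪ Set.Ioo (L - b) L, (‖w t‖₊ : ℝ≥0∞) ^ 2
      ≤ (∫⁻ t in Set.Ioo 0 b, (‖w t‖₊ : ℝ≥0∞) ^ 2) +
          ∫⁻ t in Set.Ioo (L - b) L, (‖w t‖₊ : ℝ≥0∞) ^ 2 := lintegral_union_le _ _ _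
    _ ≤ ENNReal.ofReal (b ^ 2 / 2) * (∫⁻ t in Set.Ioo 0 b, (‖deriv w t‖₊ : ℝ≥0∞) ^ 2) +
          ENNReal.ofReal (b ^ 2 / 2) * ∫⁻ t in Set.Ioo (L - b) L, (‖deriv w t‖₊ : ℝ≥0∞) ^ 2 :=
        add_le_add h1 h2
    _ = ENNReal.ofReal (b ^ 2 / 2) *
          ∫⁻ t in Set.Ioo 0 b ∪ Set.Ioo (L - b) L, (‖deriv w t‖₊ : ℝ≥0∞) ^ 2 := by
        rw [← mul_add, lintegral_union measurableSet_Ioo hdisj]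
    _ ≤ ENNReal.ofReal (b ^ 2 / 2) * ∫⁻ t in Set.Ioo 0 L, (‖deriv w t‖₊ : ℝ≥0∞) ^ 2 :=
        mul_le_mul_right (lintegral_mono_set hsub) _

/-! ### Lines in a coordinate direction of `(ℝ³)^N` -/

/-- The `(i,k)`-coordinate of the translate `X + t e_{i,k}` is `X_{ik} + t`. [folklore] -/
private theorem apply_add_smul_single {N : ℕ} (X : Config N) (t : ℝ) (i : Fin N) (k : Fin 3) :
    (X + t • (Pi.single i (EuclideanSpace.single k (1 : ℝ)) : Config N)) i k = X i k + t := by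
  simp

/-- **Averaging over translates along a coordinate line**: for measurable `H ≥ 0` on `(ℝ³)^N`
and a vector `e` moving only the `(i,k)`-coordinate, at unit speed,
`∫ H = ∫ 1_{0 < X_{ik} < 1} (∫_ℝ H(X + t e) dt) dX` (Tonelli and translation invariance).
[folklore] -/
private theorem lintegral_eq_lintegral_slab_mul {N : ℕ} (i : Fin N) (k : Fin 3) {e : Config N}
    (he : ∀ (X : Config N) (t : ℝ), (X + t • e) i k = X i k + t) {H : Config N → ℝ≥0∞}
    (hH : Measurable H) :
    ∫⁻ X, H X =
      ∫⁻ X, {Y : Config N | 0 < Y i k ∧ Y i k < 1}.indicator 1 X * ∫⁻ t : ℝ, H (X + t • e) := by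
  set U : Set (Config N) := {Y : Config N | 0 < Y i k ∧ Y i k < 1} with hU
  have hsub : ∀ (Y : Config N) (t : ℝ), (Y - t • e) i k = Y i k - t := fun Y t => by
    rw [sub_eq_add_neg, ← neg_smul, he, ← sub_eq_add_neg]
  have hcont : Continuous fun X : Config N => X i k := by fun_prop
  have hUm : MeasurableSet U :=
    ((isOpen_lt continuous_const hcont).inter (isOpen_lt hcont continuous_const)).measurableSet
  have hind : Measurable (U.indicator (1 : Config N → ℝ≥0∞)) := measurable_one.indicator hUm
  have hadd : Measurable fun p : Config N × ℝ => p.1 + p.2 • e :=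
    (show Continuous fun p : Config N × ℝ => p.1 + p.2 • e by fun_prop).measurable
  have hsubm : Measurable fun p : ℝ × Config N => p.2 - p.1 • e :=
    (show Continuous fun p : ℝ × Config N => p.2 - p.1 • e by fun_prop).measurable
  have hm1 : Measurable fun p : Config N × ℝ => U.indicator 1 p.1 * H (p.1 + p.2 • e) :=
    (hind.comp measurable_fst).mul (hH.comp hadd)
  have hm2 : Measurable fun p : ℝ × Config N => U.indicator 1 (p.2 - p.1 • e) * H p.2 :=
    (hind.comp hsubm).mul (hH.comp measurable_snd)
  -- the slab has unit width along every line
  have hslab : ∀ Y : Config N, ∫⁻ t : ℝ, U.indicator (1 : Config N → ℝ≥0∞) (Y - t • e) = 1 := by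
    intro Y
    have hY : ∀ t : ℝ, U.indicator (1 : Config N → ℝ≥0∞) (Y - t • e) =
        (Set.Ioo (Y i k - 1) (Y i k)).indicator 1 t := by
      intro t
      by_cases ht : t ∈ Set.Ioo (Y i k - 1) (Y i k)
      · have hmem : Y - t • e ∈ U := by
          simp only [hU, Set.mem_setOf_eq, hsub]
          exact ⟨by linarith [ht.2], by linarith [ht.1]⟩
        rw [Set.indicator_of_mem hmem, Set.indicator_of_mem ht]
        rfl
      · have hnmem : Y - t • e ∉ U := by
          simp only [hU, Set.mem_setOf_eq, hsub]
          exact fun h => ht ⟨by linarith [h.2], by linarith [h.1]⟩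
        rw [Set.indicator_of_notMem hnmem, Set.indicator_of_notMem ht]
    simp_rw [hY]
    rw [lintegral_indicator_one measurableSet_Ioo, Real.volume_Ioo, sub_sub_cancel,
      ENNReal.ofReal_one]
  symm
  calc ∫⁻ X, U.indicator 1 X * ∫⁻ t : ℝ, H (X + t • e)
      = ∫⁻ X, ∫⁻ t : ℝ, U.indicator 1 X * H (X + t • e) := by
        refine lintegral_congr fun X => ?_
        exact (lintegral_const_mul _ (hH.comp (hadd.comp measurable_prodMk_left))).symm
    _ = ∫⁻ t : ℝ, ∫⁻ X, U.indicator 1 X * H (X + t • e) :=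
        lintegral_lintegral_swap hm1.aemeasurable
    _ = ∫⁻ t : ℝ, ∫⁻ X, U.indicator 1 (X - t • e) * H X := by
        refine lintegral_congr fun t => ?_
        have h := lintegral_add_right_eq_self (μ := (volume : Measure (Config N)))
          (fun X => U.indicator 1 (X - t • e) * H X) (t • e)
        simp only [add_sub_cancel_right] at h
        exact h
    _ = ∫⁻ X, ∫⁻ t : ℝ, U.indicator 1 (X - t • e) * H X :=
        lintegral_lintegral_swap hm2.aemeasurable
    _ = ∫⁻ X, (∫⁻ t : ℝ, U.indicator 1 (X - t • e)) * H X := by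
        refine lintegral_congr fun X => ?_
        exact lintegral_mul_const _ (hind.comp (hsubm.comp measurable_prodMk_right))
    _ = ∫⁻ X, H X := lintegral_congr fun X => by rw [hslab, one_mul]

/-- **The layer bound in one coordinate direction**: for a Dirichlet trial state `Ψ` of `Λ_L^N`,
`0 < b`, `2b ≤ L` and `e` moving only the `(i,k)`-coordinate at unit speed,
`∫ 1_{0 < X_{ik} < L, X_{ik} < b ∨ L-b < X_{ik}} |Ψ|² ≤ (b²/2) ∫ |∂_e Ψ|²`. [folklore] -/
private theorem lintegral_indicator_layer_le {N : ℕ} {L b : ℝ} (hb : 0 < b) (hbL : 2 * b ≤ L)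
    (Ψ : TrialState N L) (i : Fin N) (k : Fin 3) {e : Config N}
    (he : ∀ (X : Config N) (t : ℝ), (X + t • e) i k = X i k + t) :
    ∫⁻ X, {Y : Config N | 0 < Y i k ∧ Y i k < L ∧ (Y i k < b ∨ L - b < Y i k)}.indicator
        (fun Y => (‖Ψ.ψ Y‖₊ : ℝ≥0∞) ^ 2) X ≤
      ENNReal.ofReal (b ^ 2 / 2) * ∫⁻ X, (‖fderiv ℝ Ψ.ψ X e‖₊ : ℝ≥0∞) ^ 2 := by
  set S : Set ℝ := {s | 0 < s ∧ s < L ∧ (s < b ∨ L - b < s)} with hS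
  set A : Set (Config N) := {Y | 0 < Y i k ∧ Y i k < L ∧ (Y i k < b ∨ L - b < Y i k)} with hA
  set B : Set (Config N) := {Y | 0 < Y i k ∧ Y i k < L} with hB
  set F : Config N → ℝ≥0∞ := fun Y => A.indicator (fun Y => (‖Ψ.ψ Y‖₊ : ℝ≥0∞) ^ 2) Y with hF
  set G : Config N → ℝ≥0∞ :=
    fun Y => B.indicator (fun Y => (‖fderiv ℝ Ψ.ψ Y e‖₊ : ℝ≥0∞) ^ 2) Y with hG
  have hcont : Continuous fun X : Config N => X i k := by fun_prop
  have hSm : MeasurableSet S := measurableSet_layer L b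
  have hAm : MeasurableSet A := hSm.preimage hcont.measurable
  have hBm : MeasurableSet B := measurableSet_Ioo.preimage hcont.measurable
  have hΨm : Measurable fun Y => (‖Ψ.ψ Y‖₊ : ℝ≥0∞) ^ 2 :=
    (Ψ.contDiff.continuous.measurable.nnnorm.coe_nnreal_ennreal).pow_const 2
  have hdm : Measurable fun Y => (‖fderiv ℝ Ψ.ψ Y e‖₊ : ℝ≥0∞) ^ 2 :=
    (((Ψ.contDiff.continuous_fderiv one_ne_zero).clm_apply
      continuous_const).measurable.nnnorm.coe_nnreal_ennreal).pow_const 2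
  have hFm : Measurable F := hΨm.indicator hAm
  have hGm : Measurable G := hdm.indicator hBm
  -- the bound on every line
  have hline : ∀ X : Config N,
      ∫⁻ t : ℝ, F (X + t • e) ≤ ENNReal.ofReal (b ^ 2 / 2) * ∫⁻ t : ℝ, G (X + t • e) := by
    intro X
    set w : ℝ → ℂ := fun s => Ψ.ψ (X + (s - X i k) • e) with hw_def
    have hγ : ∀ s, HasDerivAt (fun s : ℝ => X + (s - X i k) • e) e s := fun s => by
      have h := ((hasDerivAt_id s).sub_const (X i k)).smul_const e
      rw [one_smul] at h
      exact h.const_add X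
    have hw : ContDiff ℝ 1 w := Ψ.contDiff.comp (by fun_prop)
    have hdw : ∀ s, deriv w s = fderiv ℝ Ψ.ψ (X + (s - X i k) • e) e := fun s =>
      (((Ψ.contDiff.differentiable one_ne_zero) _).hasFDerivAt.comp_hasDerivAt s (hγ s)).deriv
    have hcoord : ∀ s, (X + (s - X i k) • e) i k = s := fun s => by
      rw [he]; ring
    have hw0 : w 0 = 0 := Ψ.eq_zero _ fun h => by
      have h1 := (h i k).1
      rw [hcoord] at h1
      exact lt_irrefl _ h1
    have hwL : w L = 0 := Ψ.eq_zero _ fun h => by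
      have h1 := (h i k).2
      rw [hcoord] at h1
      exact lt_irrefl _ h1
    have h1d := lintegral_layer_nnnorm_sq_le hb hbL hw hw0 hwL
    -- identify the two sides with the line integrals of `F` and `G`
    have hFw : ∀ t, F (X + t • e) = S.indicator (fun s => (‖w s‖₊ : ℝ≥0∞) ^ 2) (X i k + t) := by
      intro t
      have hmem : X + t • e ∈ A ↔ X i k + t ∈ S := by
        simp only [hA, hS, Set.mem_setOf_eq, he]
      have hval : w (X i k + t) = Ψ.ψ (X + t • e) := by
        simp only [hw_def, add_sub_cancel_left]
      by_cases ht : X i k + t ∈ S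
      · simp only [hF, Set.indicator_of_mem (hmem.2 ht), Set.indicator_of_mem ht, hval]
      · simp only [hF, Set.indicator_of_notMem (fun h => ht (hmem.1 h)),
          Set.indicator_of_notMem ht]
    have hGw : ∀ t, G (X + t • e) =
        (Set.Ioo 0 L).indicator (fun s => (‖deriv w s‖₊ : ℝ≥0∞) ^ 2) (X i k + t) := by
      intro t
      have hmem : X + t • e ∈ B ↔ X i k + t ∈ Set.Ioo 0 L := by
        simp only [hB, Set.mem_setOf_eq, Set.mem_Ioo, he]
      have hval : deriv w (X i k + t) = fderiv ℝ Ψ.ψ (X + t • e) e := by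
        rw [hdw, add_sub_cancel_left]
      by_cases ht : X i k + t ∈ Set.Ioo 0 L
      · simp only [hG, Set.indicator_of_mem (hmem.2 ht), Set.indicator_of_mem ht, hval]
      · simp only [hG, Set.indicator_of_notMem (fun h => ht (hmem.1 h)),
          Set.indicator_of_notMem ht]
    calc ∫⁻ t : ℝ, F (X + t • e)
        = ∫⁻ t : ℝ, S.indicator (fun s => (‖w s‖₊ : ℝ≥0∞) ^ 2) (X i k + t) :=
          lintegral_congr hFw
      _ = ∫⁻ s in S, (‖w s‖₊ : ℝ≥0∞) ^ 2 := by
          rw [lintegral_add_left_eq_self (μ := (volume : Measure ℝ))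
            (S.indicator fun s => (‖w s‖₊ : ℝ≥0∞) ^ 2) (X i k), lintegral_indicator hSm]
      _ ≤ ENNReal.ofReal (b ^ 2 / 2) * ∫⁻ s in Set.Ioo 0 L, (‖deriv w s‖₊ : ℝ≥0∞) ^ 2 := h1d
      _ = ENNReal.ofReal (b ^ 2 / 2) *
            ∫⁻ t : ℝ, (Set.Ioo 0 L).indicator (fun s => (‖deriv w s‖₊ : ℝ≥0∞) ^ 2)
              (X i k + t) := by
          rw [lintegral_add_left_eq_self (μ := (volume : Measure ℝ))
            ((Set.Ioo 0 L).indicator fun s => (‖deriv w s‖₊ : ℝ≥0∞) ^ 2) (X i k),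
            lintegral_indicator measurableSet_Ioo]
      _ = ENNReal.ofReal (b ^ 2 / 2) * ∫⁻ t : ℝ, G (X + t • e) := by
          rw [lintegral_congr hGw]
  -- average the line bounds over translates
  calc ∫⁻ X, F X
      = ∫⁻ X, {Y : Config N | 0 < Y i k ∧ Y i k < 1}.indicator 1 X * ∫⁻ t : ℝ, F (X + t • e) :=
        lintegral_eq_lintegral_slab_mul i k he hFm
    _ ≤ ∫⁻ X, {Y : Config N | 0 < Y i k ∧ Y i k < 1}.indicator 1 X *
          (ENNReal.ofReal (b ^ 2 / 2) * ∫⁻ t : ℝ, G (X + t • e)) :=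
        lintegral_mono fun X => mul_le_mul_right (hline X) _
    _ = ENNReal.ofReal (b ^ 2 / 2) *
          ∫⁻ X, {Y : Config N | 0 < Y i k ∧ Y i k < 1}.indicator 1 X *
            ∫⁻ t : ℝ, G (X + t • e) := by
        rw [← lintegral_const_mul' _ _ ENNReal.ofReal_ne_top]
        exact lintegral_congr fun X => by ring
    _ = ENNReal.ofReal (b ^ 2 / 2) * ∫⁻ X, G X := by
        rw [← lintegral_eq_lintegral_slab_mul i k he hGm]
    _ ≤ ENNReal.ofReal (b ^ 2 / 2) * ∫⁻ X, (‖fderiv ℝ Ψ.ψ X e‖₊ : ℝ≥0∞) ^ 2 :=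
        mul_le_mul_right (lintegral_mono fun X => Set.indicator_le_self _ _ X) _

/-! ### The stub -/

/-- **Registered stub `stub_shellMass`** (line `Sketch` of crux stmt-AtomisticToContinuum-9483):
`∫ (#particles in the b-layer) |Ψ|² ≤ (b²/2) ∫ |∇Ψ|²` for every Dirichlet trial state of `Λ_L^N`,
`0 < b`, `2b ≤ L`. [folklore] -/
theorem stub_shellMass :
    ∀ (N : ℕ) (L b : ℝ), 0 < b → 2 * b ≤ L → ∀ Ψ : TrialState N L,
      ∫⁻ X, (∑ i : Fin N, Set.indicator {x : Space | ∃ k : Fin 3, x k < b ∨ L - b < x k}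
          (fun _ => (1 : ℝ≥0∞)) (X i)) * (‖Ψ.ψ X‖₊ : ℝ≥0∞) ^ 2 ≤
        ENNReal.ofReal (b ^ 2 / 2) * ∫⁻ X, kineticDensity Ψ.ψ X := by
  intro N L b hb hbL Ψ
  -- the layer mass in the direction `(i,k)`
  set F : Fin N → Fin 3 → Config N → ℝ≥0∞ := fun i k X =>
    {Y : Config N | 0 < Y i k ∧ Y i k < L ∧ (Y i k < b ∨ L - b < Y i k)}.indicator
      (fun Y => (‖Ψ.ψ Y‖₊ : ℝ≥0∞) ^ 2) X with hF
  have hcont : ∀ (i : Fin N) (k : Fin 3), Continuous fun X : Config N => X i k := by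
    intro i k; fun_prop
  have hΨm : Measurable fun Y => (‖Ψ.ψ Y‖₊ : ℝ≥0∞) ^ 2 :=
    (Ψ.contDiff.continuous.measurable.nnnorm.coe_nnreal_ennreal).pow_const 2
  have hFm : ∀ (i : Fin N) (k : Fin 3), Measurable (F i k) := fun i k =>
    hΨm.indicator ((measurableSet_layer L b).preimage (hcont i k).measurable)
  have hdm : ∀ (i : Fin N) (k : Fin 3), Measurable fun X : Config N =>
      (‖fderiv ℝ Ψ.ψ X (Pi.single i (EuclideanSpace.single k (1 : ℝ)))‖₊ : ℝ≥0∞) ^ 2 :=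
    fun i k => (((Ψ.contDiff.continuous_fderiv one_ne_zero).clm_apply
      continuous_const).measurable.nnnorm.coe_nnreal_ennreal).pow_const 2
  -- pointwise: a particle in the layer of the box is in the layer of some coordinate
  have hpt : ∀ X : Config N,
      (∑ i : Fin N, Set.indicator {x : Space | ∃ k : Fin 3, x k < b ∨ L - b < x k}
          (fun _ => (1 : ℝ≥0∞)) (X i)) * (‖Ψ.ψ X‖₊ : ℝ≥0∞) ^ 2 ≤
        ∑ i : Fin N, ∑ k : Fin 3, F i k X := by
    intro X
    by_cases hX : X ∈ boxN N L
    · rw [Finset.sum_mul]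
      refine Finset.sum_le_sum fun i _ => ?_
      by_cases hi : X i ∈ {x : Space | ∃ k : Fin 3, x k < b ∨ L - b < x k}
      · obtain ⟨k, hk⟩ : ∃ k : Fin 3, X i k < b ∨ L - b < X i k := id hi
        have hmem : X ∈ {Y : Config N | 0 < Y i k ∧ Y i k < L ∧ (Y i k < b ∨ L - b < Y i k)} :=
          ⟨(hX i k).1, (hX i k).2, hk⟩
        have hFX : F i k X = (‖Ψ.ψ X‖₊ : ℝ≥0∞) ^ 2 := by
          simp only [hF, Set.indicator_of_mem hmem]
        calc Set.indicator {x : Space | ∃ k : Fin 3, x k < b ∨ L - b < x k}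
              (fun _ => (1 : ℝ≥0∞)) (X i) * (‖Ψ.ψ X‖₊ : ℝ≥0∞) ^ 2
            = F i k X := by rw [Set.indicator_of_mem hi, one_mul, hFX]
          _ ≤ ∑ k : Fin 3, F i k X :=
              Finset.single_le_sum (f := fun k => F i k X) (fun k _ => zero_le) (Finset.mem_univ k)
      · rw [Set.indicator_of_notMem hi, zero_mul]
        exact zero_le
    · rw [Ψ.eq_zero X hX]
      simp
  calc ∫⁻ X, (∑ i : Fin N, Set.indicator {x : Space | ∃ k : Fin 3, x k < b ∨ L - b < x k}
          (fun _ => (1 : ℝ≥0∞)) (X i)) * (‖Ψ.ψ X‖₊ : ℝ≥0∞) ^ 2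
      ≤ ∫⁻ X, ∑ i : Fin N, ∑ k : Fin 3, F i k X := lintegral_mono hpt
    _ = ∑ i : Fin N, ∑ k : Fin 3, ∫⁻ X, F i k X := by
        rw [lintegral_finsetSum _ fun i _ => Finset.measurable_sum _ fun k _ => hFm i k]
        exact Finset.sum_congr rfl fun i _ => lintegral_finsetSum _ fun k _ => hFm i k
    _ ≤ ∑ i : Fin N, ∑ k : Fin 3, ENNReal.ofReal (b ^ 2 / 2) *
          ∫⁻ X, (‖fderiv ℝ Ψ.ψ X (Pi.single i (EuclideanSpace.single k (1 : ℝ)))‖₊ :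
            ℝ≥0∞) ^ 2 :=
        Finset.sum_le_sum fun i _ => Finset.sum_le_sum fun k _ =>
          lintegral_indicator_layer_le hb hbL Ψ i k fun X t => apply_add_smul_single X t i k
    _ = ENNReal.ofReal (b ^ 2 / 2) * ∫⁻ X, kineticDensity Ψ.ψ X := by
        simp only [kineticDensity]
        rw [lintegral_finsetSum _ fun i _ => Finset.measurable_sum _ fun k _ => hdm i k,
          Finset.mul_sum]
        refine Finset.sum_congr rfl fun i _ => ?_
        rw [lintegral_finsetSum _ fun k _ => hdm i k, Finset.mul_sum]

end Summit.AtomisticToContinuum.BoseEinsteinCondensation.TorusInTheBox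

end
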